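import Mathlib.Analysis.Calculus.InverseFunctionTheorem.ContDiff
import Mathlib.Topology.IsLocalHomeomorph
import Mathlib.Topology.Separation.Hausdorff
import HarnessLib

/-!
# A `C^n` map with invertible derivative which is injective on a compact set is a `C^n`
# diffeomorphism onto an open set on a neighbourhood of it

General calculus (topic `Analysis/Calculus`), proofs only, over `𝕂 = ℝ` or `ℂ`: the globalisation
of the inverse function theorem along a compact set (Hirsch, *Differential Topology* (1976), Ch. 2
§1, Ex. 7 / Lang, *Real and Functional Analysis*, XIV §1; for `𝕂 = ℂ` the holomorphic version used
to turn a real-analytic totally real submanifold's complexified parametrisation into a holomorphic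
chart, Forstnerič–Kozak 2003, §4).  Let `f : E → F` be `C^n` (`n ≠ 0`) on an open set `U` of a
Banach space, with derivative a continuous linear EQUIVALENCE at every point of `U`, and injective on
a compact `K ⊆ U`.  Then:

* `isLocalHomeomorphOn_of_hasFDerivAt_equiv` — `f` is a local homeomorphism on `U` (inverse
  function theorem at each point, Mathlib `ContDiffAt.toOpenPartialHomeomorph`);
* `exists_isOpen_injOn_of_isCompact'` — `f` is injective on an open `V`, `K ⊆ V ⊆ U` (Mathlib
  `Set.InjOn.exists_isOpen_superset`);
* `isOpenMap_restrict_of_isLocalHomeomorphOn` — a local homeomorphism on an open set restricts to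
  an open map;
* `exists_openPartialHomeomorph_contDiffOn_symm` — **the package**: an `OpenPartialHomeomorph`
  `e : E ⇀ F` with `e = f`, `K ⊆ e.source ⊆ U`, whose inverse is `C^n` on `e.target = f '' e.source`
  (the global inverse agrees near each point with the local inverse of the inverse function
  theorem, which is `C^n`, Mathlib `ContDiffAt.to_localInverse`).  For `𝕂 = ℂ` this is a
  biholomorphism between open sets.

Everything is proved; no definition, no named fact.

## References

* M. W. Hirsch, *Differential Topology*, GTM 33 (1976), Ch. 2 §1, Exercise 7. [Hirsch1976]
* F. Forstnerič, J. Kozak, *Strongly pseudoconvex handlebodies*, J. Korean Math. Soc. 40 (2003),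
  §4 (arXiv:math/0305237). [ForstnericKozak2003]
-/

open Set Function Filter Topology

noncomputable section

namespace Literature.Analysis.Calculus

variable {𝕂 : Type*} [RCLike 𝕂] {E : Type*} [NormedAddCommGroup E] [NormedSpace 𝕂 E]
  [CompleteSpace E] {F : Type*} [NormedAddCommGroup F] [NormedSpace 𝕂 F]
  {f : E → F} {U K : Set E} {n : WithTop ℕ∞}

/-- **Inverse function theorem along an open set**: a `C^n` map (`n ≠ 0`) whose derivative is a
continuous linear equivalence at every point of the open set `U` is a local homeomorphism on `U`.
[cite: Hirsch1976, Ch. 2 §1] -/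
theorem isLocalHomeomorphOn_of_hasFDerivAt_equiv (hn : n ≠ 0) (hU : IsOpen U)
    (hf : ContDiffOn 𝕂 n f U)
    (hf' : ∀ x ∈ U, ∃ f' : E ≃L[𝕂] F, HasFDerivAt f (f' : E →L[𝕂] F) x) :
    IsLocalHomeomorphOn f U := by
  refine IsLocalHomeomorphOn.mk f U fun x hx => ?_
  obtain ⟨f', hfx'⟩ := hf' x hx
  have hfx : ContDiffAt 𝕂 n f x := hf.contDiffAt (hU.mem_nhds hx)
  exact ⟨hfx.toOpenPartialHomeomorph f hfx' hn, hfx.mem_toOpenPartialHomeomorph_source hfx' hn,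
    fun y _ => rfl⟩

/-- A local homeomorphism on a set is injective near each of its points. [folklore] -/
theorem exists_mem_nhds_injOn_of_isLocalHomeomorphOn {X Y : Type*} [TopologicalSpace X]
    [TopologicalSpace Y] {g : X → Y} {s : Set X} (hg : IsLocalHomeomorphOn g s) {x : X}
    (hx : x ∈ s) : ∃ u ∈ 𝓝 x, InjOn g u := by
  obtain ⟨e, hxe, heq⟩ := hg x hx
  refine ⟨e.source, e.open_source.mem_nhds hxe, fun a ha b hb hab => ?_⟩
  rw [heq] at hab
  exact e.injOn ha hb hab

omit [CompleteSpace E] in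
/-- **Injectivity spreads from a compact set to a neighbourhood** for a local homeomorphism:
if `f` is a local homeomorphism on the open `U ⊇ K`, `K` compact, and `f` is injective on `K`,
then `f` is injective on some open `V` with `K ⊆ V ⊆ U` (Hausdorff target).
[cite: Hirsch1976, Ch. 2 §1, Exercise 7] -/
theorem exists_isOpen_injOn_of_isCompact' [T2Space F] (hU : IsOpen U) (hKU : K ⊆ U)
    (hK : IsCompact K) (hloc : IsLocalHomeomorphOn f U) (hinj : InjOn f K) :
    ∃ V, IsOpen V ∧ K ⊆ V ∧ V ⊆ U ∧ InjOn f V := by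
  obtain ⟨t, hto, hKt, ht⟩ := hinj.exists_isOpen_superset hK
    (fun x hx => hloc.continuousAt (hKU hx)) fun x hx =>
      exists_mem_nhds_injOn_of_isLocalHomeomorphOn hloc (hKU hx)
  exact ⟨t ∩ U, hto.inter hU, subset_inter hKt hKU, inter_subset_right, ht.mono inter_subset_left⟩

/-- **A local homeomorphism on an open set restricts to an open map.** [folklore] -/
theorem isOpenMap_restrict_of_isLocalHomeomorphOn {X Y : Type*} [TopologicalSpace X]
    [TopologicalSpace Y] {g : X → Y} {s : Set X} (hg : IsLocalHomeomorphOn g s) (hs : IsOpen s) :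
    IsOpenMap (s.restrict g) := by
  rw [isOpenMap_iff_nhds_le]
  rintro ⟨x, hx⟩
  have h1 : map g (𝓝 x) = 𝓝 (g x) := hg.map_nhds_eq hx
  have h2 : map (Subtype.val : s → X) (𝓝 ⟨x, hx⟩) = 𝓝 x := by
    rw [map_nhds_subtype_val, hs.nhdsWithin_eq hx]
  have : s.restrict g = g ∘ (Subtype.val : s → X) := rfl
  rw [this, ← Filter.map_map, h2, h1]
  exact le_rfl

/-- **A `C^n` map with invertible derivative, injective on a compact set, is a `C^n` diffeomorphism
onto an open set on a neighbourhood of it.**  Let `f` be `C^n` (`n ≠ 0`) on the open `U` with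
derivative a continuous linear equivalence at every point of `U`, and injective on the compact
`K ⊆ U`.  Then there is an open partial homeomorphism `e : E ⇀ F` which IS `f` (`⇑e = f`), with
`K ⊆ e.source ⊆ U`, and whose inverse is `C^n` on `e.target` (`= f '' e.source`).  For `𝕂 = ℂ`,
`e` is a biholomorphism of `e.source` onto the open set `e.target`.
[cite: Hirsch1976, Ch. 2 §1, Exercise 7] -/
theorem exists_openPartialHomeomorph_contDiffOn_symm (hn : n ≠ 0) (hU : IsOpen U) (hKU : K ⊆ U)
    (hK : IsCompact K) (hf : ContDiffOn 𝕂 n f U)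
    (hf' : ∀ x ∈ U, ∃ f' : E ≃L[𝕂] F, HasFDerivAt f (f' : E →L[𝕂] F) x) (hinj : InjOn f K) :
    ∃ e : OpenPartialHomeomorph E F, ⇑e = f ∧ K ⊆ e.source ∧ e.source ⊆ U ∧
      ContDiffOn 𝕂 n e.symm e.target := by
  haveI : Nonempty E := ⟨0⟩
  have hloc := isLocalHomeomorphOn_of_hasFDerivAt_equiv hn hU hf hf'
  obtain ⟨V, hVo, hKV, hVU, hinjV⟩ := exists_isOpen_injOn_of_isCompact' hU hKU hK hloc hinj
  have hlocV : IsLocalHomeomorphOn f V := hloc.mono hVU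
  -- the partial equivalence `f : V ≃ f '' V` and the open partial homeomorphism
  set P : PartialEquiv E F := hinjV.toPartialEquiv f V with hP
  have hPsrc : P.source = V := rfl
  have hPcoe : ⇑P = f := rfl
  set e : OpenPartialHomeomorph E F := OpenPartialHomeomorph.ofContinuousOpenRestrict P
    (by rw [hPsrc, hPcoe]; exact hlocV.continuousOn)
    (by rw [hPsrc, hPcoe]; exact isOpenMap_restrict_of_isLocalHomeomorphOn hlocV hVo) (by rw [hPsrc]; exact hVo) with he
  have hecoe : ⇑e = f := rfl
  have hesrc : e.source = V := rfl
  refine ⟨e, hecoe, by rw [hesrc]; exact hKV, by rw [hesrc]; exact hVU, fun y hy => ?_⟩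
  -- near `y = f x`, `e.symm` agrees with the local inverse of the inverse function theorem
  obtain ⟨x, hxV, rfl⟩ : ∃ x ∈ e.source, e x = y := ⟨e.symm y, e.map_target hy, e.right_inv hy⟩
  rw [hesrc] at hxV
  obtain ⟨f', hfx'⟩ := hf' x (hVU hxV)
  have hfx : ContDiffAt 𝕂 n f x := hf.contDiffAt (hU.mem_nhds (hVU hxV))
  have hli : ContDiffAt 𝕂 n (hfx.localInverse hfx' hn) (f x) := hfx.to_localInverse hfx' hn
  -- the local inverse takes values in `V` near `f x`, where it must agree with `e.symm`
  set L := hfx.toOpenPartialHomeomorph f hfx' hn with hL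
  have hxL : x ∈ L.source := hfx.mem_toOpenPartialHomeomorph_source hfx' hn
  have hfxL : f x ∈ L.target := hfx.image_mem_toOpenPartialHomeomorph_target hfx' hn
  have hLsymm_cont : ContinuousAt L.symm (f x) := L.continuousAt_symm hfxL
  have hLx : L.symm (f x) = x := by
    have := L.left_inv hxL
    simpa [hL] using this
  have hev : ∀ᶠ z in 𝓝 (f x), L.symm z ∈ V ∧ z ∈ L.target := by
    have h1 : ∀ᶠ z in 𝓝 (f x), L.symm z ∈ V := by
      have : V ∈ 𝓝 (L.symm (f x)) := by rw [hLx]; exact hVo.mem_nhds hxV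
      exact hLsymm_cont this
    exact h1.and (L.open_target.mem_nhds hfxL)
  have heq : e.symm =ᶠ[𝓝 (f x)] hfx.localInverse hfx' hn := by
    filter_upwards [hev] with z hz
    have hz1 : f (L.symm z) = z := by
      have := L.right_inv hz.2
      simpa [hL] using this
    -- `e.symm z ∈ V` with `f (e.symm z) = z` as well (when `z ∈ e.target`), else use injectivity
    have hzt : z ∈ e.target := by
      rw [← hz1]
      exact e.map_source (show L.symm z ∈ e.source by rw [hesrc]; exact hz.1)
    have hz2 : f (e.symm z) = z := by
      have := e.right_inv hzt
      simpa [hecoe] using this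
    have hmem : e.symm z ∈ V := by
      have := e.map_target hzt
      rwa [hesrc] at this
    have : e.symm z = L.symm z := hinjV hmem hz.1 (hz2.trans hz1.symm)
    rw [this]
    rfl
  have key : ContDiffAt 𝕂 n e.symm (f x) := hli.congr_of_eventuallyEq heq
  exact key.contDiffWithinAt

end Literature.Analysis.Calculus

end
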